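import Summits.QuantumFields.QCD.Theses.CentreStabilisedCircle
import HarnessLib.Audit

/-!
# Birth skeleton (BC3) for the crux `CircleContinuity` (item stmt-QuantumFields-10526)

Route `CentreStabilisedCircle` (sub-problem QCD), crux decl
`Summit.QuantumFields.QCD.Theses.CentreStabilisedCircle.CircleContinuity` (rank 2, rev 6 typing through
`QCDRegularisation.HasCircleClustering` of `QCDSlabFunctional.lean`).  Registered by the skeleton-registrar seat
`planner-skel-stmt-QuantumFields-10526-0` (route re-audit bin REPAIRABLE, 2026-08-17) as
`Cruxes/CircleContinuity/Lines/birth.lean`.  It is the route-level BIRTH CERTIFICATE of the crux (two named stubs, a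
kernel-checked composition concluding the crux BY NAME, sorries only inside `stub_*`), deliberately LINE-NEUTRAL: it
cuts the crux along the route header's own TWO-LAYER PLAN

  `CircleContinuity ⇐ MidCircle (ℓ₀ ≤ L ≤ ℓ₁, deformation on: no transition) → LargeCircle (L ≥ ℓ₁, deformation off:
   finite-size transport to L = ∞)`,

placing the seam where the two halves need DIFFERENT mechanisms:

* `stub_switchOff : SwitchOffStmt` — FINITE-RANGE CONTINUATION WITH SWITCH-OFF (the adiabatic-continuity content proper;
  open-problem).  For `N_f ∈ {2,3}` and every mass-scaling, asymptotically scaling regularisation there is a heavy-quark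
  threshold `M₀` such that for every tuple `m > M₀` on the physical branch: IF the centre-stabilised circle theory
  clusters in the small window `a_k N_t ∈ [ℓ₀, 2ℓ₀]` under some profile (the crux's hypothesis, verbatim), THEN there is a
  scale `ℓ_s > 0` such that for EVERY `ℓ₁ ≥ ℓ_s` some profile `(h, θ)(k, N_t)` that is identically `(0, 0)` once
  `a_k N_t ≥ ℓ₁` makes the theory cluster on the BOUNDED band `a_k N_t ∈ [ℓ₀', 2ℓ₁]` (`0 < ℓ₀' ≤ ℓ₁`).  This is where the
  window hypothesis has teeth: a bounded band is finitely many e-folds of circle size away from the window, so a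
  continuation argument (clustering is an open condition along the deformed, centre-symmetric path; the deformation is
  switched off only beyond `ℓ_s`, i.e. below the deconfinement temperature of the undeformed heavy-quark theory) loses
  constants only finitely often.  It contains the undeformed clustering on `[ℓ₁, 2ℓ₁]` (low-temperature confined band).
* `stub_decompactify : DecompactifyStmt` — INFINITE-RANGE TRANSPORT AT ZERO PROFILE (a finite-size criterion in the circle
  direction; size XL / open).  Same outer quantifiers; there is `ℓ_c > 0` such that for every `ℓ₁ ≥ ℓ_c`: IF the UNDEFORMED,
  PERIODIC theory (`h ≡ 0`, `θ ≡ 0`) clusters on the band `a_k N_t ∈ [ℓ₁, 2ℓ₁]` THEN it clusters for ALL `a_k N_t ≥ ℓ₁` — one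
  transverse torus direction, already `≫` the correlation length, is enlarged from the band to anything, the other three
  directions being arbitrary (`2S+1 ≥ N_t`) on both sides.  Dobrushin–Shlosman / Martinelli–Olivieri shape: a mixing
  condition verified on one scale propagates to all larger scales deep inside a massive phase; `ℓ_c` exists because below
  the deconfinement length the transport is false (the first-order sheet of `Literature.Barriers.QuantumFields.
  FiniteTemperatureDeconfinement` — Borgs–Seiler — sits at small `a_k N_t`), so the stub never starts there.

`CircleContinuity_of : SwitchOffStmt → DecompactifyStmt → CircleContinuity` is kernel-checked (§4): thresholds `max`,
`ℓ₁ := max ℓ_s ℓ_c`; the switch-off band restricted to `[ℓ₁, 2ℓ₁]` is undeformed (profile congruence, §3), the transport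
stub extends it to `[ℓ₁, ∞)`, congruence carries it back under the band's profile (which vanishes there) and the union
lemma (§3, `min` of rates, `max` of constants) gives clustering on `[ℓ₀', ∞)` under ONE profile vanishing beyond `ℓ₁` —
literally the crux's conclusion.  `circleContinuity_of_stubs : CircleContinuity` instantiates it.

## Negative knowledge honoured (read 2026-08-17)
* `Cruxes/CircleContinuity/` had no workfiles (no `Disproof.lean`, no Ideas, no Lines) — `ledger crux ls stmt-QuantumFields-10526`.
* Refuter crux-attack (refuter-rattack-stmt-QuantumFields-10526-0, 2026-08-15; evidence CruxAttack.md / NonVacuity.lean): the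
  crux survives; SHAPE: the window hypothesis is logically idle (`LARGE ⇒ item`), no path-continuity is encoded.  This
  skeleton answers the shape finding by putting the window to work exactly where it can work — the BOUNDED continuation
  `stub_switchOff` — and isolating the hypothesis-free infinite-range step as a CONDITIONAL transport (`stub_decompactify`
  needs the undeformed band as input; alone it implies neither the crux nor `QCD`: BC3 probes).
* `ledger negatives --problem QuantumFields` (5 entries: RobustYangMillsRG 14958, MirrorModularBoosts 9665,
  AdaptiveCoarseSystem 9494, MultibosonLatticeGap 9599, AdmissibleRootsExist 9603): none concerns slab/circle clustering.
* Barrier `FiniteTemperatureDeconfinement` (technique classes `TemperatureBlindPolyakovConfinement`,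
  `TemperatureBlindUniformClustering`: undeformed Wilson weight, ALL couplings at FIXED temporal extent): both stubs index
  everything by the physical circle size `a_k N_t` and start the undeformed claims only beyond `ℓ_s`, `ℓ_c` — evasion (a) of
  the barrier file; `CenterSymmetryBreakingByQuarks`: no Polyakov-loop criterion is used anywhere.

## Audit (lean check --json, farm, 2026-08-17): rc 0, errors [], sorries 2 = the two `stub_*` (warnings at their two
declaration lines only), `CircleContinuity_of` axioms [propext, Classical.choice, Quot.sound] (no sorryAx); the H21 audit
lists `circleContinuity_of_stubs` as proof-of-item of `CentreStabilisedCircle.CircleContinuity` (not closed: sorryAx via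
the stubs, as intended) and the four glue lemmas as closed support.

## BC3 probes (planner folder `bc/birth_probe_switchOff.lean`, `bc/birth_probe_decompactify.lean`, one example per
tactic, `set_option maxHeartbeats 400000`; stub statements copied verbatim, no stub / composition in scope): for each
`S ∈ {SwitchOffStmt, DecompactifyStmt}` and each target `T ∈ {CircleContinuity, QCD}` the four cheap closers
`exact?` · `simpa [S, T]` · `unfold S T; simpa` · `aesop` ALL FAIL (16/16; rc 1 each file): `exact?` → heartbeat
timeout at `whnf` against the crux (and "could not close the goal" at 10× budget, `bc/birth_probe_exactq_x10.lean`) /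
"could not close the goal" against `QCD`; `simpa` → "Type mismatch: After simplification"; `aesop` → "failed to prove
the goal after exhaustive search".  Joint seam probe `SwitchOffStmt → DecompactifyStmt → CircleContinuity` by
`first | exact? | aesop` (4 000 000 heartbeats) FAILS too: the composition needs the §3 glue (profile congruence +
window union), it is not a one-line seam.
-/

noncomputable section

namespace Summit.QuantumFields.QCD.Cruxes.CircleContinuity.Birth

open Literature.MathematicalPhysics.QuantumLattice Literature.MathematicalPhysics.QuantumFieldTheory
open Summit.QuantumFields.QCD.Theses.CentreStabilisedCircle

/-! ## §1 The two stub statements -/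

/-- **(S1) Finite-range continuation with switch-off** (the adiabatic-continuity half; open-problem).  Outer quantifiers
and the window hypothesis are VERBATIM those of the crux; the conclusion is the crux's conclusion on the BOUNDED band
`a_k N_t ∈ [ℓ₀', 2ℓ₁]`, for every `ℓ₁` beyond a scale `ℓ_s > 0`, with `ℓ₀' ≤ ℓ₁` (so the undeformed stretch `[ℓ₁, 2ℓ₁]` is
inside the band).  Why plausibly true: Ünsal–Yaffe / Shifman–Ünsal continuity with the double-trace deformation keeping
the centre unbroken at every intermediate `L`, switched off only in the confined low-temperature regime `L ≥ ℓ_s > L_c(m)`;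
finitely many continuation steps.  Why it might fail: a first-order centre / chiral transition WITH the deformation on at
intermediate `L` (BonatiEtAl2021-type sheet cutting the window off), or no `k`-uniform constants through the switch-off. -/
def SwitchOffStmt : Prop :=
  ∀ Nf : ℕ, Nf = 2 ∨ Nf = 3 → ∀ reg : QCDRegularisation Nf, reg.HasMassScaling →
    (reg.scheme 0 0 0).HasAsymptoticScaling → ∃ M₀ : ℝ, 0 ≤ M₀ ∧ ∀ m : Fin Nf → ℝ, (∀ f, M₀ < m f) →
      (∀ f, ∀ᶠ k in Filter.atTop, -1 < (reg.scheme m 0 0).mq f k) →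
        (∃ ℓ₀ : ℝ, 0 < ℓ₀ ∧ ∃ (hP : ℕ → ℕ → ℝ) (θP : ℕ → ℕ → Fin Nf → ℝ),
          reg.HasCircleClustering m (fun k Nt => ℓ₀ ≤ reg.a k * Nt ∧ reg.a k * Nt ≤ 2 * ℓ₀) hP θP) →
        ∃ ℓs : ℝ, 0 < ℓs ∧ ∀ ℓ₁ : ℝ, ℓs ≤ ℓ₁ → ∃ ℓ₀ : ℝ, 0 < ℓ₀ ∧ ℓ₀ ≤ ℓ₁ ∧
          ∃ (hP : ℕ → ℕ → ℝ) (θP : ℕ → ℕ → Fin Nf → ℝ),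
            (∀ k Nt : ℕ, ℓ₁ ≤ reg.a k * Nt → hP k Nt = 0 ∧ θP k Nt = 0) ∧
              reg.HasCircleClustering m (fun k Nt => ℓ₀ ≤ reg.a k * Nt ∧ reg.a k * Nt ≤ 2 * ℓ₁) hP θP

/-- **(S2) Decompactification at zero profile** (finite-size transport in the circle direction; XL / open).  Same outer
quantifiers (own heavy-quark threshold); there is `ℓ_c > 0` such that for every `ℓ₁ ≥ ℓ_c`, clustering of the UNDEFORMED
PERIODIC circle theory (`h ≡ 0`, `θ ≡ 0`) on the band `a_k N_t ∈ [ℓ₁, 2ℓ₁]` implies clustering for all `a_k N_t ≥ ℓ₁`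
(both uniformly in `2S+1 ≥ N_t`, eventually in `k`).  Why plausibly true: deep in the massive confined phase finite-size
effects of a transverse direction of physical size `≥ ℓ₁` are `O(e^{−Δ ℓ₁})`, and a mixing condition on one scale
propagates (Dobrushin–Shlosman / Martinelli–Olivieri finite-size criteria).  Why it might fail: no such criterion is
proved for gauge fields with Wilson quarks; uniformity down to `T = 0` is the vacuum gap of heavy-quark lattice QCD for
EVERY asymptotically scaling regularisation. -/
def DecompactifyStmt : Prop :=
  ∀ Nf : ℕ, Nf = 2 ∨ Nf = 3 → ∀ reg : QCDRegularisation Nf, reg.HasMassScaling →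
    (reg.scheme 0 0 0).HasAsymptoticScaling → ∃ M₀ : ℝ, 0 ≤ M₀ ∧ ∀ m : Fin Nf → ℝ, (∀ f, M₀ < m f) →
      (∀ f, ∀ᶠ k in Filter.atTop, -1 < (reg.scheme m 0 0).mq f k) →
        ∃ ℓc : ℝ, 0 < ℓc ∧ ∀ ℓ₁ : ℝ, ℓc ≤ ℓ₁ →
          reg.HasCircleClustering m (fun k Nt => ℓ₁ ≤ reg.a k * Nt ∧ reg.a k * Nt ≤ 2 * ℓ₁)
              (fun _ _ => 0) (fun _ _ _ => 0) →
            reg.HasCircleClustering m (fun k Nt => ℓ₁ ≤ reg.a k * Nt) (fun _ _ => 0) (fun _ _ _ => 0)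

/-! ## §2 The registered stubs (the ONLY `sorry`s of this file) -/

/-- (S1) finite-range continuation with switch-off — open-problem. -/
theorem stub_switchOff : SwitchOffStmt := by
  sorry

/-- (S2) decompactification at zero profile — XL / open. -/
theorem stub_decompactify : DecompactifyStmt := by
  sorry

/-! ## §3 Glue lemmas about `HasCircleClustering` (sorry-free bookkeeping) -/

variable {Nf : ℕ}

/-- Clustering depends on the deformation/twist profiles only through their values ON the window. [folklore] -/
theorem hasCircleClusteringAt_congr {reg : QCDRegularisation Nf} {m : Fin Nf → ℝ}
    {P : ℕ → ℕ → Prop} {hP hP' : ℕ → ℕ → ℝ} {θP θP' : ℕ → ℕ → Fin Nf → ℝ} {Δ : ℝ}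
    (heq : ∀ k Nt, P k Nt → hP k Nt = hP' k Nt ∧ θP k Nt = θP' k Nt)
    (h : reg.HasCircleClusteringAt m P hP θP Δ) : reg.HasCircleClusteringAt m P hP' θP' Δ := by
  intro R R' A B
  obtain ⟨C, hC⟩ := h R R' A B
  refine ⟨C, hC.mono fun k hk Nt _ hPk S hS n hn => ?_⟩
  obtain ⟨h1, h2⟩ := heq k Nt hPk
  rw [← h1, ← h2]
  exact hk Nt hPk S hS n hn

/-- Profile congruence at some positive rate. [folklore] -/
theorem hasCircleClustering_congr {reg : QCDRegularisation Nf} {m : Fin Nf → ℝ}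
    {P : ℕ → ℕ → Prop} {hP hP' : ℕ → ℕ → ℝ} {θP θP' : ℕ → ℕ → Fin Nf → ℝ}
    (heq : ∀ k Nt, P k Nt → hP k Nt = hP' k Nt ∧ θP k Nt = θP' k Nt)
    (h : reg.HasCircleClustering m P hP θP) : reg.HasCircleClustering m P hP' θP' := by
  obtain ⟨Δ, hΔ, hc⟩ := h
  exact ⟨Δ, hΔ, hasCircleClusteringAt_congr heq hc⟩

/-- Union of two windows at a common rate (`max` of the constants, eventually-and in `k`). [folklore] -/
theorem hasCircleClusteringAt_union {reg : QCDRegularisation Nf} {m : Fin Nf → ℝ}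
    {P P' : ℕ → ℕ → Prop} {hP : ℕ → ℕ → ℝ} {θP : ℕ → ℕ → Fin Nf → ℝ} {Δ : ℝ}
    (h : reg.HasCircleClusteringAt m P hP θP Δ) (h' : reg.HasCircleClusteringAt m P' hP θP Δ) :
    reg.HasCircleClusteringAt m (fun k Nt => P k Nt ∨ P' k Nt) hP θP Δ := by
  intro R R' A B
  obtain ⟨C, hC⟩ := h R R' A B
  obtain ⟨C', hC'⟩ := h' R R' A B
  refine ⟨max C C', ?_⟩
  filter_upwards [hC, hC'] with k hk hk'
  intro Nt _ hPk S hS n hn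
  rcases hPk with hp | hp
  · exact (hk Nt hp S hS n hn).trans
      (mul_le_mul_of_nonneg_right (le_max_left C C') (Real.exp_nonneg _))
  · exact (hk' Nt hp S hS n hn).trans
      (mul_le_mul_of_nonneg_right (le_max_right C C') (Real.exp_nonneg _))

/-- Union of two windows at some positive rate (`min` of the rates). [folklore] -/
theorem hasCircleClustering_union {reg : QCDRegularisation Nf} {m : Fin Nf → ℝ}
    {P P' : ℕ → ℕ → Prop} {hP : ℕ → ℕ → ℝ} {θP : ℕ → ℕ → Fin Nf → ℝ}
    (h : reg.HasCircleClustering m P hP θP) (h' : reg.HasCircleClustering m P' hP θP) :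
    reg.HasCircleClustering m (fun k Nt => P k Nt ∨ P' k Nt) hP θP := by
  obtain ⟨Δ, hΔ, hc⟩ := h
  obtain ⟨Δ', hΔ', hc'⟩ := h'
  exact ⟨min Δ Δ', lt_min hΔ hΔ',
    hasCircleClusteringAt_union (hc.of_le (min_le_left _ _)) (hc'.of_le (min_le_right _ _))⟩

/-! ## §4 Composition (kernel-checked; no `sorry` below this line) -/

/-- **The crux from the two stubs** (concludes `CircleContinuity` BY NAME).  Thresholds: `max`; circle scale
`ℓ₁ := max ℓ_s ℓ_c`; (S1) at `ℓ₁` gives the band `[ℓ₀', 2ℓ₁]` under a profile vanishing beyond `ℓ₁`; restricted to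
`[ℓ₁, 2ℓ₁]` that profile IS zero (congruence), (S2) transports the undeformed band to `[ℓ₁, ∞)`, congruence brings it
back under the (vanishing) profile, and the union with the band is the crux's window `[ℓ₀', ∞)`. -/
theorem CircleContinuity_of :
    SwitchOffStmt → DecompactifyStmt →
      Summit.QuantumFields.QCD.Theses.CentreStabilisedCircle.CircleContinuity := by
  intro hS hD Nf hNf reg hms has
  obtain ⟨M₁, hM₁, h1⟩ := hS Nf hNf reg hms has
  obtain ⟨M₂, _hM₂, h2⟩ := hD Nf hNf reg hms has
  refine ⟨max M₁ M₂, le_max_of_le_left hM₁, fun m hm hbr hwin => ?_⟩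
  have hm1 : ∀ f, M₁ < m f := fun f => lt_of_le_of_lt (le_max_left _ _) (hm f)
  have hm2 : ∀ f, M₂ < m f := fun f => lt_of_le_of_lt (le_max_right _ _) (hm f)
  obtain ⟨ℓs, _hℓs, hband⟩ := h1 m hm1 hbr hwin
  obtain ⟨ℓc, _hℓc, hdec⟩ := h2 m hm2 hbr
  obtain ⟨ℓ₀, hℓ₀, hℓ₀₁, hP, θP, hvan, hclu⟩ := hband (max ℓs ℓc) (le_max_left _ _)
  -- the switch-off band restricted to `[ℓ₁, 2ℓ₁]` is the undeformed periodic theory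
  have hzero : reg.HasCircleClustering m
      (fun k Nt => max ℓs ℓc ≤ reg.a k * Nt ∧ reg.a k * Nt ≤ 2 * max ℓs ℓc)
      (fun _ _ => 0) (fun _ _ _ => 0) :=
    hasCircleClustering_congr (fun k Nt hk => hvan k Nt hk.1)
      (hclu.mono fun k Nt hk => ⟨hℓ₀₁.trans hk.1, hk.2⟩)
  -- (S2): transport the undeformed band to every larger circle
  have hlarge := hdec (max ℓs ℓc) (le_max_right _ _) hzero
  -- back under the profile `(hP, θP)`, which vanishes on `[ℓ₁, ∞)`
  have hlarge' : reg.HasCircleClustering m (fun k Nt => max ℓs ℓc ≤ reg.a k * Nt) hP θP :=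
    hasCircleClustering_congr (fun k Nt hk => ⟨(hvan k Nt hk).1.symm, (hvan k Nt hk).2.symm⟩) hlarge
  refine ⟨ℓ₀, max ℓs ℓc, hℓ₀, hP, θP, hvan, ?_⟩
  refine (hasCircleClustering_union hclu hlarge').mono fun k Nt hk => ?_
  rcases le_or_gt (max ℓs ℓc) (reg.a k * Nt) with hge | hlt
  · exact Or.inr hge
  · refine Or.inl ⟨hk, hlt.le.trans ?_⟩
    exact le_mul_of_one_le_left (hℓ₀.le.trans hℓ₀₁) (by norm_num)

/-- The crux along this skeleton, from the registered stubs (sorries only inside `stub_*`). -/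
theorem circleContinuity_of_stubs :
    Summit.QuantumFields.QCD.Theses.CentreStabilisedCircle.CircleContinuity :=
  CircleContinuity_of stub_switchOff stub_decompactify

end Summit.QuantumFields.QCD.Cruxes.CircleContinuity.Birth

end
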